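import Summits.Ventures.LatticeQCDFlow.Scoring.InfiniteVolumeUltralocal2D
import Summits.Ventures.LatticeQCDFlow.Scoring.StringTensionWeakCoupling
import HarnessLib

/-!
# The one-loop law of the plaquette OF THE INFINITE-VOLUME two-dimensional `U(N)` / `SU(N)` theory: `β(1 − ⟨N⁻¹ Re tr U_p⟩_{μ_β}) → N/2`, `(N²−1)/(2N)`

HONEST FRAMING: exact (Metropolis-corrected) sampling algorithms for lattice gauge theory;
figures of merit are autocorrelation/cost numbers at stated couplings and volumes; no
continuum-physics claim.

Venture `LatticeQCDFlow` (cell pub-lqcd), sub-topic `Scoring`; FANOUT row 5 (`s0-sun-a`), GEN-20.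
NEW WORK of the cell (placement rule).  GEN-19 (24) `InfiniteVolumeUltralocal2D`: under EVERY infinite-volume limit
point `μ` of the two-dimensional Wilson theory at coupling `β`, the plaquette variable `U_p` has the tilted Haar law, so
`⟨f(U_p)⟩_μ = ∫ f e^{−β(N − Re tr)} dHaar / ∫ e^{−β(N − Re tr)} dHaar`.  GEN-20 `PlaquetteWeakCoupling` /
`PlaquetteWeakCouplingSU` / `StringTensionWeakCoupling`: the one-loop laws of that ratio.  Hence, for ANY selection
`β ↦ μ_β` of infinite-volume states and any plaquette `p`:

* **`tendsto_mul_one_sub_infiniteVolume_unitary_plaquette`** — `β (1 − ⟨N⁻¹ Re tr U_p⟩_{μ_β}) → N/2` (`U(N)`, `N ≥ 1`);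
* **`tendsto_mul_one_sub_infiniteVolume_specialUnitary_plaquette`** — `→ (N² − 1)/(2N)` (`SU(N)`, `N ≥ 1`);
* `tendsto_mul_neg_log_infiniteVolume_unitary_plaquette`, `tendsto_mul_neg_log_infiniteVolume_specialUnitary_plaquette` —
  the same for `β · (−log|⟨N⁻¹ Re tr U_p⟩_{μ_β}|)` (the exact 2-d string tension in lattice units).

No `def`, nothing cited as a fact, 0 sorry.
-/

noncomputable section

open MeasureTheory Filter Topology
open Literature.MathematicalPhysics.QuantumFieldTheory
open Literature.MathematicalPhysics.QuantumLattice

namespace Summit.Ventures.LatticeQCDFlow.Scoring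


/-- **ONE-LOOP LAW OF THE INFINITE-VOLUME 2-d `U(N)` PLAQUETTE** (`N ≥ 1`): for every plaquette `p` and every
selection `β ↦ μ_β ∈ infiniteVolumeLimitPoints ρ_{U(N)} β`, `β · (1 − ∫ N⁻¹ Re tr U_p dμ_β) → N/2` as `β → ∞`. -/
theorem tendsto_mul_one_sub_infiniteVolume_unitary_plaquette (N : ℕ) [NeZero N] (z : (Literature.Probability.LatticeModels.Site 2))
    (μ : ℝ → Measure (LGConfig 2 (Matrix.unitaryGroup (Fin N) ℂ)))
    (hμ : ∀ β, μ β ∈ infiniteVolumeLimitPoints (unitaryFundamentalRep (Fin N) ℂ) β) :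
    Tendsto (fun β : ℝ => β * (1 - ∫ V, ((plaquetteHolonomyZd V z 0 1 : Matrix.unitaryGroup (Fin N) ℂ) :
      Matrix (Fin N) (Fin N) ℂ).trace.re / N ∂(μ β))) atTop (𝓝 ((N : ℝ) / 2)) := by
  have hf : Continuous fun g : Matrix.unitaryGroup (Fin N) ℂ =>
      ((g : Matrix.unitaryGroup (Fin N) ℂ) : Matrix (Fin N) (Fin N) ℂ).trace.re / N :=
    (Complex.continuous_re.comp (continuous_id.matrix_trace.comp continuous_subtype_val)).div_const _
  have key : ∀ β : ℝ, ∫ V, ((plaquetteHolonomyZd V z 0 1 : Matrix.unitaryGroup (Fin N) ℂ) :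
      Matrix (Fin N) (Fin N) ℂ).trace.re / N ∂(μ β)
      = (∫ u, ((u : Matrix.unitaryGroup (Fin N) ℂ) : Matrix (Fin N) (Fin N) ℂ).trace.re / N *
          Real.exp (-(β * ((N : ℝ) - ((u : Matrix.unitaryGroup (Fin N) ℂ) : Matrix (Fin N) (Fin N) ℂ).trace.re)))
          ∂(haarProbability (Matrix.unitaryGroup (Fin N) ℂ))) /
        ∫ u, Real.exp (-(β * ((N : ℝ) - ((u : Matrix.unitaryGroup (Fin N) ℂ) : Matrix (Fin N) (Fin N) ℂ).trace.re)))
          ∂(haarProbability (Matrix.unitaryGroup (Fin N) ℂ)) := fun β =>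
    integral_plaquetteObs_eq_of_mem_two (unitaryFundamentalRep (Fin N) ℂ) (continuous_unitaryFundamentalRep (Fin N) ℂ)
      (hμ β) z hf
  simp_rw [key]
  exact tendsto_mul_one_sub_unitary_plaquette N

/-- **ONE-LOOP LAW OF THE INFINITE-VOLUME 2-d `SU(N)` PLAQUETTE** (`N ≥ 1`): `β · (1 − ∫ N⁻¹ Re tr U_p dμ_β) → (N² − 1)/(2N)`. -/
theorem tendsto_mul_one_sub_infiniteVolume_specialUnitary_plaquette (N : ℕ) [NeZero N] (z : (Literature.Probability.LatticeModels.Site 2))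
    (μ : ℝ → Measure (LGConfig 2 (Matrix.specialUnitaryGroup (Fin N) ℂ)))
    (hμ : ∀ β, μ β ∈ infiniteVolumeLimitPoints (fundamentalRep (Fin N)) β) :
    Tendsto (fun β : ℝ => β * (1 - ∫ V, ((plaquetteHolonomyZd V z 0 1 : Matrix.specialUnitaryGroup (Fin N) ℂ) :
      Matrix (Fin N) (Fin N) ℂ).trace.re / N ∂(μ β))) atTop (𝓝 (((N : ℝ) ^ 2 - 1) / (2 * N))) := by
  have hf : Continuous fun g : Matrix.specialUnitaryGroup (Fin N) ℂ =>
      ((g : Matrix.specialUnitaryGroup (Fin N) ℂ) : Matrix (Fin N) (Fin N) ℂ).trace.re / N :=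
    (Complex.continuous_re.comp (continuous_id.matrix_trace.comp continuous_subtype_val)).div_const _
  have key : ∀ β : ℝ, ∫ V, ((plaquetteHolonomyZd V z 0 1 : Matrix.specialUnitaryGroup (Fin N) ℂ) :
      Matrix (Fin N) (Fin N) ℂ).trace.re / N ∂(μ β)
      = (∫ u, ((u : Matrix.specialUnitaryGroup (Fin N) ℂ) : Matrix (Fin N) (Fin N) ℂ).trace.re / N *
          Real.exp (-(β * ((N : ℝ) - ((u : Matrix.specialUnitaryGroup (Fin N) ℂ) : Matrix (Fin N) (Fin N) ℂ).trace.re)))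
          ∂(haarProbability (Matrix.specialUnitaryGroup (Fin N) ℂ))) /
        ∫ u, Real.exp (-(β * ((N : ℝ) - ((u : Matrix.specialUnitaryGroup (Fin N) ℂ) :
          Matrix (Fin N) (Fin N) ℂ).trace.re))) ∂(haarProbability (Matrix.specialUnitaryGroup (Fin N) ℂ)) := fun β =>
    integral_plaquetteObs_eq_of_mem_two (fundamentalRep (Fin N)) (continuous_fundamentalRep (Fin N)) (hμ β) z hf
  simp_rw [key]
  exact tendsto_mul_one_sub_specialUnitary_plaquette N

/-- The `U(N)` string-tension form: `β · (−log|∫ N⁻¹ Re tr U_p dμ_β|) → N/2`. -/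
theorem tendsto_mul_neg_log_infiniteVolume_unitary_plaquette (N : ℕ) [NeZero N] (z : (Literature.Probability.LatticeModels.Site 2))
    (μ : ℝ → Measure (LGConfig 2 (Matrix.unitaryGroup (Fin N) ℂ)))
    (hμ : ∀ β, μ β ∈ infiniteVolumeLimitPoints (unitaryFundamentalRep (Fin N) ℂ) β) :
    Tendsto (fun β : ℝ => β * -Real.log |∫ V, ((plaquetteHolonomyZd V z 0 1 : Matrix.unitaryGroup (Fin N) ℂ) :
      Matrix (Fin N) (Fin N) ℂ).trace.re / N ∂(μ β)|) atTop (𝓝 ((N : ℝ) / 2)) := by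
  have hf : Continuous fun g : Matrix.unitaryGroup (Fin N) ℂ =>
      ((g : Matrix.unitaryGroup (Fin N) ℂ) : Matrix (Fin N) (Fin N) ℂ).trace.re / N :=
    (Complex.continuous_re.comp (continuous_id.matrix_trace.comp continuous_subtype_val)).div_const _
  have key : ∀ β : ℝ, ∫ V, ((plaquetteHolonomyZd V z 0 1 : Matrix.unitaryGroup (Fin N) ℂ) :
      Matrix (Fin N) (Fin N) ℂ).trace.re / N ∂(μ β)
      = (∫ u, ((u : Matrix.unitaryGroup (Fin N) ℂ) : Matrix (Fin N) (Fin N) ℂ).trace.re / N *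
          Real.exp (-(β * ((N : ℝ) - ((u : Matrix.unitaryGroup (Fin N) ℂ) : Matrix (Fin N) (Fin N) ℂ).trace.re)))
          ∂(haarProbability (Matrix.unitaryGroup (Fin N) ℂ))) /
        ∫ u, Real.exp (-(β * ((N : ℝ) - ((u : Matrix.unitaryGroup (Fin N) ℂ) : Matrix (Fin N) (Fin N) ℂ).trace.re)))
          ∂(haarProbability (Matrix.unitaryGroup (Fin N) ℂ)) := fun β =>
    integral_plaquetteObs_eq_of_mem_two (unitaryFundamentalRep (Fin N) ℂ) (continuous_unitaryFundamentalRep (Fin N) ℂ)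
      (hμ β) z hf
  simp_rw [key]
  exact tendsto_mul_neg_log_unitary_plaquette N

/-- The `SU(N)` string-tension form: `β · (−log|∫ N⁻¹ Re tr U_p dμ_β|) → (N² − 1)/(2N)`. -/
theorem tendsto_mul_neg_log_infiniteVolume_specialUnitary_plaquette (N : ℕ) [NeZero N] (z : (Literature.Probability.LatticeModels.Site 2))
    (μ : ℝ → Measure (LGConfig 2 (Matrix.specialUnitaryGroup (Fin N) ℂ)))
    (hμ : ∀ β, μ β ∈ infiniteVolumeLimitPoints (fundamentalRep (Fin N)) β) :
    Tendsto (fun β : ℝ => β * -Real.log |∫ V, ((plaquetteHolonomyZd V z 0 1 : Matrix.specialUnitaryGroup (Fin N) ℂ) :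
      Matrix (Fin N) (Fin N) ℂ).trace.re / N ∂(μ β)|) atTop (𝓝 (((N : ℝ) ^ 2 - 1) / (2 * N))) := by
  have hf : Continuous fun g : Matrix.specialUnitaryGroup (Fin N) ℂ =>
      ((g : Matrix.specialUnitaryGroup (Fin N) ℂ) : Matrix (Fin N) (Fin N) ℂ).trace.re / N :=
    (Complex.continuous_re.comp (continuous_id.matrix_trace.comp continuous_subtype_val)).div_const _
  have key : ∀ β : ℝ, ∫ V, ((plaquetteHolonomyZd V z 0 1 : Matrix.specialUnitaryGroup (Fin N) ℂ) :
      Matrix (Fin N) (Fin N) ℂ).trace.re / N ∂(μ β)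
      = (∫ u, ((u : Matrix.specialUnitaryGroup (Fin N) ℂ) : Matrix (Fin N) (Fin N) ℂ).trace.re / N *
          Real.exp (-(β * ((N : ℝ) - ((u : Matrix.specialUnitaryGroup (Fin N) ℂ) : Matrix (Fin N) (Fin N) ℂ).trace.re)))
          ∂(haarProbability (Matrix.specialUnitaryGroup (Fin N) ℂ))) /
        ∫ u, Real.exp (-(β * ((N : ℝ) - ((u : Matrix.specialUnitaryGroup (Fin N) ℂ) :
          Matrix (Fin N) (Fin N) ℂ).trace.re))) ∂(haarProbability (Matrix.specialUnitaryGroup (Fin N) ℂ)) := fun β =>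
    integral_plaquetteObs_eq_of_mem_two (fundamentalRep (Fin N)) (continuous_fundamentalRep (Fin N)) (hμ β) z hf
  simp_rw [key]
  exact tendsto_mul_neg_log_specialUnitary_plaquette N

end Summit.Ventures.LatticeQCDFlow.Scoring
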